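import Literature.Analysis.OperatorTheory.Enflo2023.Basic
import HarnessLib

/-!
# Enflo 2023, v2 p.23: the type-2 endgame through a weak limit

Source under adjudication: Per H. Enflo, *On the invariant subspace problem in Hilbert spaces*, arXiv:2305.15442 (v1
2023, v2 2024), bib key `Enflo2023` — a CLAIMED proof of the invariant subspace problem for operators on a separable
Hilbert space.  This file is part of the kernel-tight typing of the manuscript by the b2b-enflo repair cell
(formaliser 2, Part B: (28)–(47), the limiting argument and the final deduction).  It records what FOLLOWS (proved
implications from the manuscript's displayed hypotheses) and, where a step does not follow, the typed inference
together with its refutation.  NOTHING here asserts that the manuscript's main theorem holds; no declaration concludes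
the invariant subspace problem for an arbitrary operator.  Value (BLOCK-2b): theorems / refutations of typed
inferences about a text — not progress on the problem.

EnfloISP — Part B (formaliser 2).  The TYPE-2 ENDGAME, v2 pp.22–23 (lines 734–755 of the LaTeX source):
"If, for every n, when we have started over, 2.) happens for some i = i(n) …, then for y'_{ni} we have, for
j ≥ m, |⟨T^j y'_{ni}, x₀⟩| ≤ |⟨T^j y'_{ni}, y'_{ni}⟩| + |⟨T^j ℓ'_{ni}(T)y'_{ni}, x₀ − ℓ'_{ni}(T)y'_{ni}⟩|
+ ‖T^j(y'_{ni} − ℓ'_{ni}(T)y'_{ni})‖ + ‖ℓ_{ni}(T)y'_{ni} − y'_{ni}‖ → 0 for every j ≥ m as n → ∞ and, for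
w-lim_{n→∞} y'_{ni} = y'_∞ we get T^m y'_∞ non-cyclic, since ⟨T^j y'_∞, x₀⟩ = 0 for j ≥ m."
Typed here with every hypothesis explicit.  Dictionary: paper ⟨u, v⟩ = Mathlib `⟪v, u⟫_ℂ`; `y n` = y'_{n i(n)},
`w n` = ℓ'_{n i(n)}(T) y'_{n i(n)}.
STATUS: CLOSED (zero sorry) — the deduction FOLLOWS from the listed hypotheses.  Two of them are imported, not
proved here: (c) ‖y'_{ni} − ℓ'_{ni}(T)y'_{ni}‖ → 0 (Part A bookkeeping: dominating a₀, (24)–(27)/(33)) and the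
non-vanishing of the weak limit, which the paper does not mention; we supply it from ‖x₀‖ = 1, ‖x₀ − y‖ ≤ 0.7
(lemma `re_inner_ge_of_norm_sub_le`: Re⟨y, x₀⟩ ≥ 0.255), see STEPS.md row B-T2-5.
-/

open scoped InnerProductSpace
open Filter Topology RCLike

namespace Literature.Analysis.OperatorTheory.Enflo2023

variable {H : Type*} [NormedAddCommGroup H] [InnerProductSpace ℂ H]

/-- If `‖x₀‖ = 1` and `‖x₀ - y‖ ≤ 0.7` then `Re ⟪x₀, y⟫ ≥ 0.255` (polarisation). Supplies the non-vanishing of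
weak limits of MC iterates, which the paper uses tacitly on p.23. [folklore] -/
lemma re_inner_ge_of_norm_sub_le {x₀ y : H} (hx₀ : ‖x₀‖ = 1) (hy : ‖x₀ - y‖ ≤ 0.7) :
    (0.255 : ℝ) ≤ re ⟪x₀, y⟫_ℂ := by
  have h1 : ‖x₀ - y‖ ^ 2 = ‖x₀‖ ^ 2 - 2 * re ⟪x₀, y⟫_ℂ + ‖y‖ ^ 2 := @norm_sub_sq ℂ _ _ _ _ x₀ y
  have h2 : ‖x₀ - y‖ ^ 2 ≤ 0.7 ^ 2 := by
    exact pow_le_pow_left₀ (norm_nonneg _) hy 2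
  rw [hx₀] at h1
  nlinarith [norm_nonneg y, sq_nonneg ‖y‖]

/-- A weak limit of vectors `y n` with `Re ⟪x₀, y n⟫ ≥ c > 0` is non-zero. [cite: Enflo2023, v2 p.23] -/
lemma weakLimit_ne_zero {x₀ : H} {y : ℕ → H} {ylim : H} {c : ℝ} (hc : 0 < c)
    (hweak : ∀ v : H, Tendsto (fun n => ⟪v, y n⟫_ℂ) atTop (𝓝 ⟪v, ylim⟫_ℂ))
    (hre : ∀ n, c ≤ re ⟪x₀, y n⟫_ℂ) : ylim ≠ 0 := by
  have hlim : Tendsto (fun n => re ⟪x₀, y n⟫_ℂ) atTop (𝓝 (re ⟪x₀, ylim⟫_ℂ)) :=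
    (continuous_re.tendsto _).comp (hweak x₀)
  have hge : c ≤ re ⟪x₀, ylim⟫_ℂ := ge_of_tendsto' hlim hre
  rintro rfl
  simp at hge
  linarith

/-- Weak limits kill the tail of the orbit against `x₀`: if `y n ⇀ ylim` and `⟪x₀, T^j (y n)⟫ → 0` for every
`j ≥ m`, then `⟪x₀, T^j ylim⟫ = 0` for every `j ≥ m` (pass `T^j` to the other side as an adjoint). [cite: Enflo2023, v2 p.23] -/
theorem inner_pow_weakLimit_eq_zero [CompleteSpace H] (T : H →L[ℂ] H) (x₀ : H) (y : ℕ → H) (ylim : H)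
    (m : ℕ) (hweak : ∀ v : H, Tendsto (fun n => ⟪v, y n⟫_ℂ) atTop (𝓝 ⟪v, ylim⟫_ℂ))
    (h : ∀ j, m ≤ j → Tendsto (fun n => ⟪x₀, (T ^ j) (y n)⟫_ℂ) atTop (𝓝 0)) :
    ∀ j, m ≤ j → ⟪x₀, (T ^ j) ylim⟫_ℂ = 0 := by
  intro j hj
  have key : ∀ v : H, ⟪x₀, (T ^ j) v⟫_ℂ = ⟪ContinuousLinearMap.adjoint (T ^ j) x₀, v⟫_ℂ := fun v => by
    rw [ContinuousLinearMap.adjoint_inner_left]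
  have h1 : Tendsto (fun n => ⟪x₀, (T ^ j) (y n)⟫_ℂ) atTop (𝓝 ⟪x₀, (T ^ j) ylim⟫_ℂ) := by
    simp_rw [key]; exact hweak _
  exact tendsto_nhds_unique h1 (h j hj)

/-- The paper's three-term estimate (v2 p.23), typed: for fixed `j`,
`|⟨T^j y, x₀⟩| ≤ |⟨T^j y, y⟩| + |⟨T^j w, x₀ − w⟩| + ‖T^j (y − w)‖·‖x₀ − y‖ + ‖T^j w‖·‖w − y‖`
(the paper drops the two bounded norm factors).  Pure inner-product algebra. [folklore] -/
lemma norm_inner_pow_le (T : H →L[ℂ] H) (x₀ y w : H) (j : ℕ) :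
    ‖⟪x₀, (T ^ j) y⟫_ℂ‖ ≤ ‖⟪y, (T ^ j) y⟫_ℂ‖ + ‖⟪x₀ - w, (T ^ j) w⟫_ℂ‖
      + ‖(T ^ j) (y - w)‖ * ‖x₀ - y‖ + ‖(T ^ j) w‖ * ‖w - y‖ := by
  have hdecomp : ⟪x₀, (T ^ j) y⟫_ℂ = ⟪y, (T ^ j) y⟫_ℂ + ⟪x₀ - w, (T ^ j) w⟫_ℂ
      + ⟪x₀ - y, (T ^ j) (y - w)⟫_ℂ + ⟪w - y, (T ^ j) w⟫_ℂ := by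
    simp only [map_sub, inner_sub_left, inner_sub_right]
    ring
  have e3 : ‖⟪x₀ - y, (T ^ j) (y - w)⟫_ℂ‖ ≤ ‖(T ^ j) (y - w)‖ * ‖x₀ - y‖ := by
    rw [mul_comm]; exact norm_inner_le_norm _ _
  have e4 : ‖⟪w - y, (T ^ j) w⟫_ℂ‖ ≤ ‖(T ^ j) w‖ * ‖w - y‖ := by
    rw [mul_comm]; exact norm_inner_le_norm _ _
  have n1 := norm_add_le (⟪y, (T ^ j) y⟫_ℂ + ⟪x₀ - w, (T ^ j) w⟫_ℂ + ⟪x₀ - y, (T ^ j) (y - w)⟫_ℂ)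
    ⟪w - y, (T ^ j) w⟫_ℂ
  have n2 := norm_add_le (⟪y, (T ^ j) y⟫_ℂ + ⟪x₀ - w, (T ^ j) w⟫_ℂ) ⟪x₀ - y, (T ^ j) (y - w)⟫_ℂ
  have n3 := norm_add_le ⟪y, (T ^ j) y⟫_ℂ ⟪x₀ - w, (T ^ j) w⟫_ℂ
  rw [hdecomp]
  linarith

/-- From the three hypotheses of the endgame to `⟪x₀, T^j (y n)⟫ → 0`:
(a) `⟪y n, T^j (y n)⟫ → 0` (case 2.): `|⟨T^j y'_{ni}, y'_{ni}⟩| < γ^{1/10}(εθ)_n → 0`),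
(b) `‖⟪x₀ − w n, T^j (w n)⟫‖ ≤ ε n → 0` ((9) with `(εθ)_n → 0`),
(c) `‖w n − y n‖ → 0` (imported from Part A's bookkeeping),
with the orbit data bounded (`‖x₀ − y n‖ ≤ B`, `‖w n‖ ≤ B`). [cite: Enflo2023, v2 p.23] -/
theorem tendsto_inner_pow_zero (T : H →L[ℂ] H) (x₀ : H) (y w : ℕ → H) (ε : ℕ → ℝ) (j : ℕ) (B : ℝ)
    (ha : Tendsto (fun n => ⟪y n, (T ^ j) (y n)⟫_ℂ) atTop (𝓝 0))
    (hb : ∀ n, ‖⟪x₀ - w n, (T ^ j) (w n)⟫_ℂ‖ ≤ ε n) (hε : Tendsto ε atTop (𝓝 0))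
    (hc : Tendsto (fun n => ‖w n - y n‖) atTop (𝓝 0))
    (hB1 : ∀ n, ‖x₀ - y n‖ ≤ B) (hB2 : ∀ n, ‖w n‖ ≤ B) :
    Tendsto (fun n => ⟪x₀, (T ^ j) (y n)⟫_ℂ) atTop (𝓝 0) := by
  have hB : 0 ≤ B := (norm_nonneg _).trans (hB2 0)
  rw [tendsto_zero_iff_norm_tendsto_zero]
  -- majorant
  have hmaj : ∀ n, ‖⟪x₀, (T ^ j) (y n)⟫_ℂ‖ ≤ ‖⟪y n, (T ^ j) (y n)⟫_ℂ‖ + ε n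
      + ‖T ^ j‖ * B * ‖w n - y n‖ + ‖T ^ j‖ * B * ‖w n - y n‖ := by
    intro n
    have h0 := norm_inner_pow_le T x₀ (y n) (w n) j
    have h3 : ‖(T ^ j) (y n - w n)‖ * ‖x₀ - y n‖ ≤ ‖T ^ j‖ * B * ‖w n - y n‖ := by
      calc ‖(T ^ j) (y n - w n)‖ * ‖x₀ - y n‖ ≤ (‖T ^ j‖ * ‖y n - w n‖) * B :=
            mul_le_mul ((T ^ j).le_opNorm _) (hB1 n) (norm_nonneg _)
              (mul_nonneg (norm_nonneg _) (norm_nonneg _))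
        _ = ‖T ^ j‖ * B * ‖w n - y n‖ := by rw [norm_sub_rev]; ring
    have h4 : ‖(T ^ j) (w n)‖ * ‖w n - y n‖ ≤ ‖T ^ j‖ * B * ‖w n - y n‖ := by
      have : ‖(T ^ j) (w n)‖ ≤ ‖T ^ j‖ * B :=
        ((T ^ j).le_opNorm _).trans (mul_le_mul_of_nonneg_left (hB2 n) (norm_nonneg _))
      exact mul_le_mul_of_nonneg_right this (norm_nonneg _)
    linarith [hb n]
  have hlim : Tendsto (fun n => ‖⟪y n, (T ^ j) (y n)⟫_ℂ‖ + ε n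
      + ‖T ^ j‖ * B * ‖w n - y n‖ + ‖T ^ j‖ * B * ‖w n - y n‖) atTop (𝓝 0) := by
    have h1 := ha.norm
    rw [norm_zero] at h1
    have h3 : Tendsto (fun n => ‖T ^ j‖ * B * ‖w n - y n‖) atTop (𝓝 0) := by
      simpa using hc.const_mul (‖T ^ j‖ * B)
    simpa using ((h1.add hε).add h3).add h3
  exact squeeze_zero (fun n => norm_nonneg _) hmaj hlim

/-- Powers of an injective operator are injective (paper's standing WLOG: `T` one-to-one, p.2). [folklore] -/
lemma injective_pow (T : H →L[ℂ] H) (hT : Function.Injective T) (m : ℕ) :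
    Function.Injective (T ^ m) := by
  induction m with
  | zero => intro a b hab; simpa using hab
  | succ k ih =>
    intro a b hab
    rw [pow_succ] at hab
    -- `(T^k * T) a = (T^k) (T a)` definitionally
    exact hT (ih hab)

/-- THE TYPE-2 ENDGAME (v2 p.23), end to end from typed hypotheses: `T` injective (paper's WLOG p.2),
`‖x₀‖ = 1`; MC outputs `y n` (= y'_{n i(n)}) with `‖x₀ − y n‖ ≤ 0.7`, converging WEAKLY to `ylim`; and for every
`j ≥ m`, `⟪x₀, T^j (y n)⟫ → 0` (from `tendsto_inner_pow_zero`).  Then `T` has a non-trivial closed invariant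
subspace: the orbit closure of `T^m ylim`, which is orthogonal to `x₀`. [cite: Enflo2023, v2 p.23] -/
theorem hasNontrivialClosedInvariantSubspace_of_type2_endgame [CompleteSpace H] (T : H →L[ℂ] H)
    (hT : Function.Injective T) (x₀ : H) (hx₀ : ‖x₀‖ = 1) (y : ℕ → H) (ylim : H) (m : ℕ)
    (hdist : ∀ n, ‖x₀ - y n‖ ≤ 0.7)
    (hweak : ∀ v : H, Tendsto (fun n => ⟪v, y n⟫_ℂ) atTop (𝓝 ⟪v, ylim⟫_ℂ))
    (h : ∀ j, m ≤ j → Tendsto (fun n => ⟪x₀, (T ^ j) (y n)⟫_ℂ) atTop (𝓝 0)) :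
    HasNontrivialClosedInvariantSubspace T := by
  have hylim : ylim ≠ 0 :=
    weakLimit_ne_zero (by norm_num) hweak fun n => re_inner_ge_of_norm_sub_le hx₀ (hdist n)
  have hTm : Function.Injective (T ^ m) := injective_pow T hT m
  have hne : (T ^ m) ylim ≠ 0 := by
    intro h0; apply hylim; apply hTm; simpa using h0
  have hx : x₀ ≠ 0 := by rintro rfl; simp at hx₀
  have horth := inner_pow_weakLimit_eq_zero T x₀ y ylim m hweak h
  refine hasNontrivialClosedInvariantSubspace_of_orbit_orthogonal' T hne hx fun k => ?_
  have : (T ^ k) ((T ^ m) ylim) = (T ^ (k + m)) ylim := by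
    rw [pow_add]; rfl
  rw [this]
  exact horth (k + m) (by omega)

end Literature.Analysis.OperatorTheory.Enflo2023
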